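import Summits.CriticalPhenomena.PercolationContinuityZ3.Theorems.PercLowPointHalfSpaceLowPointBookkeepingOfSharpStubs
import Summits.CriticalPhenomena.PercolationContinuityZ3.Theorems.PercLowPointHalfSpaceLowPointBookkeepingSharpReduce
import Summits.CriticalPhenomena.PercolationContinuityZ3.Theorems.PercLowPointHalfSpaceLowPointBookkeepingSharpDominatesLog
import Summits.CriticalPhenomena.PercolationContinuityZ3.Theorems.PercLowPointHalfSpaceLowPointBookkeepingSharpDominatesExp

/-!
# `LowPointBookkeeping` (crux K, stmt-CriticalPhenomena-14713) — the strategist's SPLIT glue `K ⇐ A♯ₛ ∧ B♯`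

Route `PercLowPointHalfSpace`, crux
`K := Summit.CriticalPhenomena.PercolationContinuityZ3.Theses.PercLowPointHalfSpace.LowPointBookkeeping`
(`BoundaryTwoArmDecay → TallClusterMassBound → QuantitativeBGN → [P_{p_c}(0 ↔ n e₀) → 0]`).

Five concordant line leads (c0–c4), the standing disprover (`Cruxes/LowPointBookkeeping/Disproof.lean` §1–§5), both
round-1 crux triagers and the round-2 ideators agree: no bookkeeping proof of K runs through its own hypotheses
A (adjacent-root ℍ-disjoint two-arm event, exponent `5/2 + κ`), B (rooted first moment on the matched-scale arm
event, exponent `11/4`) and C (`∃ a > 0`) — exponent-level jump worlds (the thin-trunk bushy forest of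
`FindingsIdeator4.md` §2) are consistent with A ∧ B ∧ C and every tool in the tree, while `¬K ⟺ A ∧ B ∧ C ∧ θ(p_c) > 0`
(`LowPointBookkeeping.Negative.not_lowPointBookkeeping_iff`).  The one registered skeleton (line SketchIdeator1,
floor-russo) is kernel-closed modulo exactly two hypothesis-stubs, and this file records that composition as the
typed DECOMPOSITION of the crux used by `ledger route edit … --split LowPointBookkeeping` (crux-strategist, D-0019
glued split, two layers):

* `Sub₁ = BoundaryTwoArmSharpDiluted` (A♯ₛ; registered stub `stub_twoArmSharpFloorE1` verbatim): under the
  floor-diluted critical half-space measure `P^{ℍ}_{p_c,s}`, uniformly in the floor density `s ∈ [0,1]`, the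
  probability that `C_ℍ(0)` and `C_ℍ(e)`, `e = (0,1,0)`, are ℍ-disjoint and both reach sup-distance `r` is
  `≤ C r^{-(11/4+κ)}` for some `κ > 0`;
* `Sub₂ = NoFatHalfBoxOrigin` (B♯; registered stub `stub_noFatHalfBoxOrigin` verbatim): on the induced critical
  half-space graph (`P^{ℍ}_{p_c,1}`) the largest ℍ-cluster trace in the half-box `B_n ∩ ℍ` has `≥ C n^{11/4}`
  vertices with probability `≤ 1/e`, for all `n ≥ 1`.

Main results (all one-line compositions of LANDED theorems; sorry-free):

* `LowPointBookkeeping_of_subs : Sub₁ → Sub₂ → LowPointBookkeeping` — the split glue (registered stub of the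
  same name on stmt-CriticalPhenomena-14713): `Glue.lowPointBookkeeping_of_sharp` (p119553) after the canonical
  reductions `Reduce.twoArmSharpFloor_of_e1`, `Reduce.noFatHalfBox_of_origin` (p134668);
* `percolationContinuityZ3_of_subs : Sub₁ → Sub₂ → PercolationContinuityZ3` — the two children decide the
  conjunct `θ(p_c(ℤ³)) = 0` directly (`Glue.percolationContinuityZ3_of_sharp`: window average of `τ`, `θ² ≤ τ`,
  qualitative BGN for the floor term), so a later tenure pass may re-glue `closes (h₁ : Sub₁) (h₂ : Sub₂)`;
* dominance of the children over the route's typed cruxes: `boundaryTwoArmDecay_of_sub₁ : Sub₁ → BoundaryTwoArmDecay`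
  (A♯ₛ ⇒ A, `Glue.boundaryTwoArmDecay_of_sharp`), `tallClusterMassBound_log_of_sub₂` (B♯ ⇒ B up to `1 + log r`,
  `Dominates.tallClusterMassBound_log_of_noFatHalfBox`, p134403) and `tallClusterMassBound_of_sub₂_exp`
  (B♯ with any exponent `m < 11/4` ⇒ B by name, `Dominates.tallClusterMassBound_of_noFatHalfBox_exp`, p135127).

Why the pieces are genuine (neither is K or the conjunct reworded): `Sub₁` holds at `p = 1` (adjacent roots are
joined, cf. `Negative.twoArmAt_one`) where the conjunct fails, and is believed in a jump world too (saturation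
`a₂ = d = 3 > 11/4`; MC `a₂(s) = 2.90–2.97`, kit j015667/j015398); `Sub₂` is ℍ-native (no `θ²` floor under `τ_ℍ`,
BGN) and every conjunct-strength sufficient condition for it in the tree (`SquareSubharmonic`, the bulk ball sum,
`BulkNoFat`) is strictly stronger (lead c3 addendum, `Lines/SketchIdeator1-dead.md`); real-world margin `11/4 − d_f
= 0.23`, MC `P^{ℍ}(K_max ≥ n^{11/4}) = 0.33 → 0.03` for `n = 16 → 96` (kit j021729).  No definitions; no new facts.

References: Barsky–Grimmett–Newman 1991 [BarskyGrimmettNewman1991]; Grimmett, *Percolation* (1999) §7.2, §8.5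
[GrimmettPercolation1999]; Hutchcroft, universal tightness (arXiv:2008.11197) [Hutchcroft2021];
Aizenman–Grimmett 1991 (floor dilution / essential enhancements) [AizenmanGrimmett1991].
-/

noncomputable section

open MeasureTheory Filter Topology
open Literature.Probability.Percolation Literature.Probability.LatticeModels

namespace Summit.CriticalPhenomena.PercolationContinuityZ3.Theorems.LowPointBookkeeping.Split

open Summit.CriticalPhenomena.PercolationContinuityZ3.Theses.PercLowPointHalfSpace
open Summit.CriticalPhenomena.PercolationContinuityZ3.Theorems.FloorRusso

/-! ## The split glue (registered stub `LowPointBookkeeping_of_subs`) -/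

/-- **Split glue `K ⇐ Sub₁ ∧ Sub₂`.**  The crux `LowPointBookkeeping` from its two sub-cruxes
`BoundaryTwoArmSharpDiluted` (A♯ₛ, first binder, verbatim) and `NoFatHalfBoxOrigin` (B♯, second binder,
verbatim): canonical reductions (`Reduce.*`, p134668) followed by the landed floor-russo composition
`Glue.lowPointBookkeeping_of_sharp` (p119553).  The route's own A, B, C are not used. [folklore] -/
theorem LowPointBookkeeping_of_subs : (∃ κ C : ℝ, 0 < κ ∧ ∀ s : unitInterval, ∀ r : ℕ, 1 ≤ r → (floorDilutedPercolation 3 (criticalProbI 3) s).real ({ω | ∃ y : Site 3, (∃ i : Fin 3, (r : ℤ) ≤ |y i|) ∧ ω ∈ openConnIn {x : Site 3 | 0 ≤ x 0} 0 y} ∩ {ω | ∃ y : Site 3, (∃ i : Fin 3, (r : ℤ) ≤ |y i - (Pi.single 1 1 : Site 3) i|) ∧ ω ∈ openConnIn {x : Site 3 | 0 ≤ x 0} (Pi.single 1 1 : Site 3) y} ∩ (openConnIn {x : Site 3 | 0 ≤ x 0} 0 (Pi.single 1 1 : Site 3))ᶜ) ≤ C * (r : ℝ) ^ (-(11 / 4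 + κ))) → (∃ C : ℝ, 0 < C ∧ ∀ n : ℕ, 1 ≤ n → (floorDilutedPercolation 3 (criticalProbI 3) 1).real {ω | C * (n : ℝ) ^ ((11 : ℝ) / 4) ≤ (clusterMaxIn ((box 3 n).filter fun z : Site 3 => 0 ≤ z 0) ω : ℝ)} ≤ Real.exp (-1)) → Summit.CriticalPhenomena.PercolationContinuityZ3.Theses.PercLowPointHalfSpace.LowPointBookkeeping :=
  fun hA hB => Glue.lowPointBookkeeping_of_sharp (Reduce.twoArmSharpFloor_of_e1 hA) (Reduce.noFatHalfBox_of_origin hB)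

/-! ## The children decide the conjunct directly -/

/-- **`θ(p_c(ℤ³)) = 0` from the two sub-cruxes alone** (`Glue.percolationContinuityZ3_of_sharp`: `θ² ≤` window
average of `τ` `≤ π_s(L) + 4 C L^{-κ/2} → 0`; crux C is not needed, only the qualitative BGN limit). [folklore] -/
theorem percolationContinuityZ3_of_subs
    (hA : ∃ κ C : ℝ, 0 < κ ∧ ∀ s : unitInterval, ∀ r : ℕ, 1 ≤ r →
      (floorDilutedPercolation 3 (criticalProbI 3) s).real
        ({ω | ∃ y : Site 3, (∃ i : Fin 3, (r : ℤ) ≤ |y i|) ∧ ω ∈ openConnIn {x : Site 3 | 0 ≤ x 0} 0 y} ∩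
          {ω | ∃ y : Site 3, (∃ i : Fin 3, (r : ℤ) ≤ |y i - (Pi.single 1 1 : Site 3) i|) ∧
            ω ∈ openConnIn {x : Site 3 | 0 ≤ x 0} (Pi.single 1 1 : Site 3) y} ∩
          (openConnIn {x : Site 3 | 0 ≤ x 0} 0 (Pi.single 1 1 : Site 3))ᶜ) ≤ C * (r : ℝ) ^ (-(11 / 4 + κ)))
    (hB : ∃ C : ℝ, 0 < C ∧ ∀ n : ℕ, 1 ≤ n →
      (floorDilutedPercolation 3 (criticalProbI 3) 1).real
        {ω | C * (n : ℝ) ^ ((11 : ℝ) / 4) ≤ (clusterMaxIn ((box 3 n).filter fun z : Site 3 => 0 ≤ z 0) ω : ℝ)}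
          ≤ Real.exp (-1)) :
    _root_.PercolationContinuityZ3 :=
  Glue.percolationContinuityZ3_of_sharp (Reduce.twoArmSharpFloor_of_e1 hA) (Reduce.noFatHalfBox_of_origin hB)

/-! ## The children dominate the route's typed cruxes A and B -/

/-- **Sub₁ ⇒ A**: the floor-uniform sharp two-arm bound at `s = 1`, `e = (0,1,0)` gives the route's crux
`BoundaryTwoArmDecay` (exponent `11/4 + κ ≥ 5/2 + κ`; `Glue.boundaryTwoArmDecay_of_sharp`). [folklore] -/
theorem boundaryTwoArmDecay_of_sub₁
    (hA : ∃ κ C : ℝ, 0 < κ ∧ ∀ s : unitInterval, ∀ r : ℕ, 1 ≤ r →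
      (floorDilutedPercolation 3 (criticalProbI 3) s).real
        ({ω | ∃ y : Site 3, (∃ i : Fin 3, (r : ℤ) ≤ |y i|) ∧ ω ∈ openConnIn {x : Site 3 | 0 ≤ x 0} 0 y} ∩
          {ω | ∃ y : Site 3, (∃ i : Fin 3, (r : ℤ) ≤ |y i - (Pi.single 1 1 : Site 3) i|) ∧
            ω ∈ openConnIn {x : Site 3 | 0 ≤ x 0} (Pi.single 1 1 : Site 3) y} ∩
          (openConnIn {x : Site 3 | 0 ≤ x 0} 0 (Pi.single 1 1 : Site 3))ᶜ) ≤ C * (r : ℝ) ^ (-(11 / 4 + κ))) :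
    BoundaryTwoArmDecay :=
  Glue.boundaryTwoArmDecay_of_sharp (Reduce.twoArmSharpFloor_of_e1 hA)

/-- **Sub₂ ⇒ B up to `1 + log r`** (`Dominates.tallClusterMassBound_log_of_noFatHalfBox`, p134403: truncation of
the rooted mass at `2 log(15876 r⁵)` times the typical `K_max`, Hutchcroft's universal tightness tail on the
rest, absorbed into the one-scale floor `π_s(r) ≥ 1/(588 r²)`). [folklore] -/
theorem tallClusterMassBound_log_of_sub₂
    (hB : ∃ C : ℝ, 0 < C ∧ ∀ n : ℕ, 1 ≤ n →
      (floorDilutedPercolation 3 (criticalProbI 3) 1).real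
        {ω | C * (n : ℝ) ^ ((11 : ℝ) / 4) ≤ (clusterMaxIn ((box 3 n).filter fun z : Site 3 => 0 ≤ z 0) ω : ℝ)}
          ≤ Real.exp (-1)) :
    ∃ C : ℝ, ∀ r : ℕ, 1 ≤ r →
      ∑ x ∈ box 3 r, (bondPercolation (zdGraph 3) (criticalProbI 3)).real (openConnIn {x : Site 3 | 0 ≤ x 0} 0 x ∩
          {ω | ∃ y : Site 3, (∃ i : Fin 3, (r : ℤ) ≤ |y i|) ∧ ω ∈ openConnIn {x : Site 3 | 0 ≤ x 0} 0 y}) ≤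
        C * (r : ℝ) ^ ((11 : ℝ) / 4) * (1 + Real.log r) *
          (bondPercolation (zdGraph 3) (criticalProbI 3)).real
            {ω | ∃ y : Site 3, (∃ i : Fin 3, (r : ℤ) ≤ |y i|) ∧ ω ∈ openConnIn {x : Site 3 | 0 ≤ x 0} 0 y} :=
  Dominates.tallClusterMassBound_log_of_noFatHalfBox (Reduce.noFatHalfBox_of_origin hB)

/-- **Sub₂ with any exponent `m < 11/4` ⇒ B by name** (`Dominates.tallClusterMassBound_of_noFatHalfBox_exp`,
p135127): the `log` is absorbed by `r^{11/4 - m}`; the real-world value is `m = d_f ≈ 2.52`. [folklore] -/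
theorem tallClusterMassBound_of_sub₂_exp {m : ℝ} (hm0 : 0 ≤ m) (hm : m < 11 / 4)
    (hB : ∃ C : ℝ, 0 < C ∧ ∀ n : ℕ, 1 ≤ n →
      (floorDilutedPercolation 3 (criticalProbI 3) 1).real
        {ω | C * (n : ℝ) ^ m ≤ (clusterMaxIn ((box 3 n).filter fun z : Site 3 => 0 ≤ z 0) ω : ℝ)}
          ≤ Real.exp (-1)) :
    TallClusterMassBound :=
  Dominates.stub_sharpDominatesB m hm0 hm hB

end Summit.CriticalPhenomena.PercolationContinuityZ3.Theorems.LowPointBookkeeping.Split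

end
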